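import Summits.CriticalPhenomena.PercolationContinuityZ3.Theorems.PercNearOneGluingNoHeavyLowerTailSahiCombFiveUpSetProof

/-!
# The five-up-set inequality, RANK route III: (RANK-Z_a⁺) — the rank theorem for an ARBITRARY bounded index poset

Support file of the one-cut programme (crux `NoHeavyLowerTail`, stmt-CriticalPhenomena-4575; cell `prim-masterthm` seat P5, gen 9;
memo `FROM-prim-masterthm-p5-g9-RANKZA-CERT.md`, report `P5-LORENTZIAN-TEST.md` §14.2).  Setting (report §11.10): the triangle class of
(M⁺⁺-3) with a block `E₁₂` of size `a` is governed by TWO increasing families `F, G : X → Up(2^[n])` indexed by the cube `X = 2^a`;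
prim-lf-1's `rankZ_kernel_eq_zero` (`…SahiCombFiveUpSetProof`) is the case `X = {⊥ < ⊤}`.  Here the index set is ANY finite
partial order `ι` with `⊥ ≠ ⊤`, and `F, G` are monotone families of up-sets of the cube `Finset α`.

* **`rankZA_kernel_eq_zero`** — (RANK-Z_a⁺) at `P = ⊤` in function language.  Tokens: DEMANDS `D₁ = {d ∈ F ⊤ : dᶜ ∈ G ⊥}` at level `⊤`,
  `D₂ = {d ∈ G ⊤ : dᶜ ∈ F ⊥}` at level `⊥`, and for every level `x` the new family `D₃(x) = {d : dᶜ ∈ F x ∩ G x, dᶜ ∉ F ⊥, dᶜ ∉ G ⊥}`;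
  SUPPLIES `T(y) = F y ∩ G y` at level `y`; matrix `Z[(d,x),(t,y)] = [d ⊆ t][x ≤ y]` (the zeta function of the product cube `ι × 2^α`).
  The theorem: if coefficient vectors `a` (on `D₁`), `b` (on `D₂`), `c x` (on `D₃ x`) satisfy, for every `y` and every `t ∈ F y ∩ G y`,
  `[y = ⊤]·Σ_d a_d [d ⊆ t] + Σ_d b_d [d ⊆ t] + Σ_{x ≤ y} Σ_d c_{x,d} [d ⊆ t] = 0`, then `a = b = 0` and every `c x = 0` — the rows of `Z`
  are linearly independent.  PROOF (memo §1): by well-founded induction on the level `y`, read the level-`y` equation in the antipodal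
  basis of `ℚ^{F y ∩ G y}` (support lemma `exists_support_coef`, C1 `eq_zero_of_zeta_sum_eq_zero` of `…SahiCombFiveUpSetRank`):
  a `D₃(y)`-token `d` IS the basis vector indexed by `d` (`dᶜ ∈ F y ∩ G y`), the `D₁`-part has coordinates only at `e` with `eᶜ ∈ G ⊥`,
  the `D₂`-part only at `eᶜ ∈ F ⊥`, so the coordinate at `d` reads `c_{y,d} = 0`; with all `c = 0` the two remaining equations are
  exactly prim-lf-1's (RANK-Z) for `A₀ = F ⊥ ⊆ A₁ = F ⊤`, `B₀ = G ⊥ ⊆ B₁ = G ⊤`.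
* **`rankZA_kernel_eq_zero_of_upperSet`** — the same inside an arbitrary up-set `P` (supports in `P`, equations only on `P`): the
  restriction to `P` is free because a demand `d ∈ P` only sees `t ⊇ d`.
What it gives (counting, in the companion inequality file / memo): for every up-set `P`,
`Σ_y #(P ∩ F y ∩ G y) ≥ #(P ∩ F ⊤ ∩ refl(G ⊥)) + #(P ∩ G ⊤ ∩ refl(F ⊥)) + Σ_y #(P ∩ (refl(F y ∩ G y) \ (refl F ⊥ ∪ refl G ⊥)))`
((♠_a⁺); `a = 1`: the five-up-set inequality).  What it does NOT give: `TRI_W(a) ≥ 0` for `a ≥ 2` (report §14.2: the complementary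
piece is sign-indefinite); it is the one-copy building block of the two-copy certificates of report §14.4–14.5.
HONEST LABEL: complete proofs, std axioms; linear algebra over `ℚ` only. [this work]
-/

namespace Summit.CriticalPhenomena.PercolationContinuityZ3.Theorems

namespace FiveUpSet

open Finset

variable {α : Type*} [DecidableEq α] [Fintype α]
variable {ι : Type*} [PartialOrder ι] [Fintype ι] [DecidableEq ι] [OrderBot ι] [OrderTop ι]
  [DecidableRel ((· ≤ ·) : ι → ι → Prop)]

/-! ### (RANK-Z_a⁺) at `P = ⊤`: the kernel is trivial -/

/-- **(RANK-Z_a⁺), kernel form at `P = ⊤`.**  `F, G` monotone families of up-sets of the cube indexed by a finite bounded poset `ι`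
with `⊥ ≠ ⊤`; `a` supported on `D₁ = {d ∈ F ⊤ : dᶜ ∈ G ⊥}`, `b` on `D₂ = {d ∈ G ⊤ : dᶜ ∈ F ⊥}`, `c x` on
`D₃ x = {d : dᶜ ∈ F x ∩ G x, dᶜ ∉ F ⊥, dᶜ ∉ G ⊥}`.  If for every level `y` and every `t ∈ F y ∩ G y`
`[y = ⊤]·Σ_d a_d [d ⊆ t] + Σ_d b_d [d ⊆ t] + Σ_x [x ≤ y]·Σ_d c_{x,d} [d ⊆ t] = 0`, then `a = 0`, `b = 0` and all `c x = 0`: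
the rows of the zeta matrix `[d ⊆ t][x ≤ y]` (demands × supplies) are linearly independent. [this work] -/
theorem rankZA_kernel_eq_zero (hι : (⊥ : ι) ≠ ⊤) (F G : ι → Finset (Finset α))
    (hF : ∀ x, IsUpperSet (F x : Set (Finset α))) (hG : ∀ x, IsUpperSet (G x : Set (Finset α)))
    (hFm : Monotone F) (hGm : Monotone G)
    (a b : Finset α → ℚ) (c : ι → Finset α → ℚ)
    (ha : ∀ d, a d ≠ 0 → d ∈ F ⊤ ∧ dᶜ ∈ G ⊥)
    (hb : ∀ d, b d ≠ 0 → d ∈ G ⊤ ∧ dᶜ ∈ F ⊥)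
    (hc : ∀ x d, c x d ≠ 0 → dᶜ ∈ F x ∧ dᶜ ∈ G x ∧ dᶜ ∉ F ⊥ ∧ dᶜ ∉ G ⊥)
    (h : ∀ y, ∀ t, t ∈ F y → t ∈ G y →
      (if y = ⊤ then ∑ d, a d * (if d ⊆ t then (1 : ℚ) else 0) else 0) +
        ∑ d, b d * (if d ⊆ t then (1 : ℚ) else 0) +
        ∑ x, (if x ≤ y then ∑ d, c x d * (if d ⊆ t then (1 : ℚ) else 0) else 0) = 0) :
    (∀ d, a d = 0) ∧ (∀ d, b d = 0) ∧ (∀ x d, c x d = 0) := by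
  -- STEP 1: kill the `D₃`-coefficients level by level (well-founded induction on `ι`)
  have hc0 : ∀ y, ∀ d, c y d = 0 := by
    intro y
    refine WellFoundedLT.induction (motive := fun y => ∀ d, c y d = 0) y ?_
    intro y ih
    -- the up-set `W = F y ∩ G y` and the antipodal coordinates of every zeta function on it
    have hW : IsUpperSet ((F y ∩ G y : Finset (Finset α)) : Set (Finset α)) := by
      rw [coe_inter]; exact (hF y).inter (hG y)
    choose cf hcfδ hcfsupp hcfid using fun d => exists_support_coef hW d
    have transfer : ∀ (x : Finset α → ℚ), ∀ t ∈ F y ∩ G y,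
        ∑ e, (∑ d, x d * cf d e) * (if e ⊆ t then (1 : ℚ) else 0) = ∑ d, x d * (if d ⊆ t then (1 : ℚ) else 0) := by
      intro x t ht
      calc ∑ e, (∑ d, x d * cf d e) * (if e ⊆ t then (1 : ℚ) else 0)
          = ∑ e, ∑ d, x d * (cf d e * (if e ⊆ t then (1 : ℚ) else 0)) := by
            refine sum_congr rfl fun e _ => ?_
            rw [Finset.sum_mul]
            exact sum_congr rfl fun d _ => by ring
        _ = ∑ d, ∑ e, x d * (cf d e * (if e ⊆ t then (1 : ℚ) else 0)) := Finset.sum_comm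
        _ = ∑ d, x d * ∑ e, cf d e * (if e ⊆ t then (1 : ℚ) else 0) := by
            refine sum_congr rfl fun d _ => ?_
            rw [Finset.mul_sum]
        _ = ∑ d, x d * (if d ⊆ t then (1 : ℚ) else 0) := by
            refine sum_congr rfl fun d _ => ?_
            rw [← hcfid d t ht]
    -- the level-`x` sums for `x ≠ y` vanish (below `y`: induction; not below `y`: absent)
    have hlow : ∀ t, ∑ x, (if x ≤ y then ∑ d, c x d * (if d ⊆ t then (1 : ℚ) else 0) else 0)
        = ∑ d, c y d * (if d ⊆ t then (1 : ℚ) else 0) := by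
      intro t
      rw [Finset.sum_eq_single y]
      · rw [if_pos le_rfl]
      · intro x _ hxy
        by_cases hle : x ≤ y
        · rw [if_pos hle]
          refine Finset.sum_eq_zero fun d _ => ?_
          rw [ih x (lt_of_le_of_ne hle hxy) d, zero_mul]
        · rw [if_neg hle]
      · intro hy; exact absurd (Finset.mem_univ y) hy
    -- coordinate vectors of the `D₁`- and `D₂`-parts; the `D₃(y)`-part is its own coordinate vector
    obtain ⟨Aco, hAco⟩ : ∃ f : Finset α → ℚ, ∀ e, f e = ∑ d, a d * cf d e := ⟨_, fun _ => rfl⟩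
    obtain ⟨Bco, hBco⟩ : ∃ f : Finset α → ℚ, ∀ e, f e = ∑ d, b d * cf d e := ⟨_, fun _ => rfl⟩
    have hCco : ∀ e, ∑ d, c y d * cf d e = c y e := by
      intro e
      have hterm : ∀ d, c y d * cf d e = if e = d then c y e else 0 := by
        intro d
        by_cases h0 : c y d = 0
        · rw [h0, zero_mul]
          split_ifs with hed
          · rw [hed, h0]
          · rfl
        · have hdW : dᶜ ∈ F y ∩ G y := by
            obtain ⟨h1', h2', -, -⟩ := hc y d h0
            exact mem_inter.2 ⟨h1', h2'⟩
          rw [hcfδ d hdW]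
          dsimp only
          split_ifs with hed
          · rw [hed, mul_one]
          · rw [mul_zero]
      rw [Finset.sum_congr rfl fun d _ => hterm d, Finset.sum_ite_eq]
      simp
    have hAsupp : ∀ e, Aco e ≠ 0 → eᶜ ∈ F y ∩ G y ∧ eᶜ ∈ G ⊥ := by
      intro e he
      rw [hAco e] at he
      obtain ⟨d, -, hd⟩ := Finset.exists_ne_zero_of_sum_ne_zero he
      have had : a d ≠ 0 := left_ne_zero_of_mul hd
      obtain ⟨heW, hed⟩ := hcfsupp d e (right_ne_zero_of_mul hd)
      exact ⟨heW, hG ⊥ (Finset.compl_subset_compl.2 hed) (ha d had).2⟩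
    have hBsupp : ∀ e, Bco e ≠ 0 → eᶜ ∈ F y ∩ G y ∧ eᶜ ∈ F ⊥ := by
      intro e he
      rw [hBco e] at he
      obtain ⟨d, -, hd⟩ := Finset.exists_ne_zero_of_sum_ne_zero he
      have hbd : b d ≠ 0 := left_ne_zero_of_mul hd
      obtain ⟨heW, hed⟩ := hcfsupp d e (right_ne_zero_of_mul hd)
      exact ⟨heW, hF ⊥ (Finset.compl_subset_compl.2 hed) (hb d hbd).2⟩
    -- the level-`y` equation in antipodal coordinates: `[y = ⊤]·Aco + Bco + c y = 0`
    obtain ⟨g, hg⟩ : ∃ f : Finset α → ℚ, ∀ e, f e = (if y = ⊤ then Aco e else 0) + Bco e + c y e := ⟨_, fun _ => rfl⟩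
    have hrel : ∀ t ∈ F y ∩ G y, ∑ e, g e * (if e ⊆ t then (1 : ℚ) else 0) = 0 := by
      intro t ht
      have ht1 : t ∈ F y := (mem_inter.1 ht).1
      have ht2 : t ∈ G y := (mem_inter.1 ht).2
      have hsplit : ∑ e, g e * (if e ⊆ t then (1 : ℚ) else 0)
          = (if y = ⊤ then ∑ d, a d * (if d ⊆ t then (1 : ℚ) else 0) else 0) +
            ∑ d, b d * (if d ⊆ t then (1 : ℚ) else 0) + ∑ d, c y d * (if d ⊆ t then (1 : ℚ) else 0) := by
        have e3 : ∀ e, g e = (if y = ⊤ then ∑ d, a d * cf d e else 0) + (∑ d, b d * cf d e) + (∑ d, c y d * cf d e) := by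
          intro e; rw [hg e, hAco e, hBco e, hCco e]
        simp only [e3, add_mul, Finset.sum_add_distrib]
        rw [transfer b t ht, transfer (c y) t ht]
        congr 2
        by_cases hy : y = ⊤
        · simp only [if_pos hy]; exact transfer a t ht
        · simp only [if_neg hy, zero_mul, Finset.sum_const_zero]
      rw [hsplit, ← hlow t]
      exact h y t ht1 ht2
    have hg0 : ∀ e, g e = 0 := by
      refine eq_zero_of_zeta_sum_eq_zero hW g ?_ hrel
      intro e he
      by_contra hW'
      have h1' : (if y = ⊤ then Aco e else 0) = 0 := by
        by_cases hy : y = ⊤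
        · rw [if_pos hy]; by_contra h'; exact hW' (hAsupp e h').1
        · rw [if_neg hy]
      have h2' : Bco e = 0 := by by_contra h'; exact hW' (hBsupp e h').1
      have h3' : c y e = 0 := by
        by_contra h'
        obtain ⟨x1, x2, -, -⟩ := hc y e h'
        exact hW' (mem_inter.2 ⟨x1, x2⟩)
      apply he
      rw [hg e, h1', h2', h3']; ring
    -- at a `D₃(y)`-index the other two coordinate vectors vanish
    intro e
    by_contra hne
    obtain ⟨-, -, hnF, hnG⟩ := hc y e hne
    have h1' : (if y = ⊤ then Aco e else 0) = 0 := by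
      by_cases hy : y = ⊤
      · rw [if_pos hy]; by_contra h'; exact hnG (hAsupp e h').2
      · rw [if_neg hy]
    have h2' : Bco e = 0 := by by_contra h'; exact hnF (hBsupp e h').2
    have h0 := hg0 e
    rw [hg e, h1', h2', zero_add, zero_add] at h0
    exact hne h0
  -- STEP 2: with `c = 0` the levels `⊤` and `⊥` give exactly (RANK-Z) for `F ⊥ ⊆ F ⊤`, `G ⊥ ⊆ G ⊤`
  have hcsum0 : ∀ y t, ∑ x, (if x ≤ y then ∑ d, c x d * (if d ⊆ t then (1 : ℚ) else 0) else 0) = 0 := by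
    intro y t
    refine Finset.sum_eq_zero fun x _ => ?_
    split_ifs
    · exact Finset.sum_eq_zero fun d _ => by rw [hc0 x d, zero_mul]
    · rfl
  have h1 : ∀ t, t ∈ F ⊤ → t ∈ G ⊤ →
      ∑ d, a d * (if d ⊆ t then (1 : ℚ) else 0) + ∑ d, b d * (if d ⊆ t then (1 : ℚ) else 0) = 0 := by
    intro t ht1 ht2
    have e := h ⊤ t ht1 ht2
    rwa [if_pos rfl, hcsum0 ⊤ t, add_zero] at e
  have h2 : ∀ t, t ∈ F ⊥ → t ∈ G ⊥ → ∑ d, b d * (if d ⊆ t then (1 : ℚ) else 0) = 0 := by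
    intro t ht1 ht2
    have e := h ⊥ t ht1 ht2
    rwa [if_neg hι, hcsum0 ⊥ t, zero_add, add_zero] at e
  have K := rankZ_kernel_eq_zero (F ⊥) (F ⊤) (G ⊥) (G ⊤) (hF ⊥) (hF ⊤) (hG ⊥) (hG ⊤) (hFm bot_le) (hGm bot_le) a b
    (fun d hd => ha d hd) (fun d hd => Or.inl ⟨(hb d hd).2, (hb d hd).1⟩) h1 h2
  exact ⟨K.1, K.2, hc0⟩

/-- **(RANK-Z_a⁺), kernel form for a general up-set `P`** (the restriction to `P` is free).  Same as `rankZA_kernel_eq_zero` with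
all supports inside `P` and the equations required only at `t ∈ P`: at `t ∉ P` every term `[d ⊆ t]` with `d ∈ P` vanishes because
`P` is an up-set. [this work] -/
theorem rankZA_kernel_eq_zero_of_upperSet (hι : (⊥ : ι) ≠ ⊤) (P : Finset (Finset α)) (F G : ι → Finset (Finset α))
    (hP : IsUpperSet (P : Set (Finset α)))
    (hF : ∀ x, IsUpperSet (F x : Set (Finset α))) (hG : ∀ x, IsUpperSet (G x : Set (Finset α)))
    (hFm : Monotone F) (hGm : Monotone G)
    (a b : Finset α → ℚ) (c : ι → Finset α → ℚ)
    (ha : ∀ d, a d ≠ 0 → d ∈ P ∧ d ∈ F ⊤ ∧ dᶜ ∈ G ⊥)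
    (hb : ∀ d, b d ≠ 0 → d ∈ P ∧ d ∈ G ⊤ ∧ dᶜ ∈ F ⊥)
    (hc : ∀ x d, c x d ≠ 0 → d ∈ P ∧ dᶜ ∈ F x ∧ dᶜ ∈ G x ∧ dᶜ ∉ F ⊥ ∧ dᶜ ∉ G ⊥)
    (h : ∀ y, ∀ t, t ∈ P → t ∈ F y → t ∈ G y →
      (if y = ⊤ then ∑ d, a d * (if d ⊆ t then (1 : ℚ) else 0) else 0) +
        ∑ d, b d * (if d ⊆ t then (1 : ℚ) else 0) +
        ∑ x, (if x ≤ y then ∑ d, c x d * (if d ⊆ t then (1 : ℚ) else 0) else 0) = 0) :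
    (∀ d, a d = 0) ∧ (∀ d, b d = 0) ∧ (∀ x d, c x d = 0) := by
  have vanish : ∀ (x : Finset α → ℚ), (∀ d, x d ≠ 0 → d ∈ P) → ∀ t, t ∉ P →
      ∑ d, x d * (if d ⊆ t then (1 : ℚ) else 0) = 0 := by
    intro x hx t ht
    refine Finset.sum_eq_zero fun d _ => ?_
    by_cases hd : x d = 0
    · rw [hd, zero_mul]
    · have hdt : ¬ d ⊆ t := fun h' => ht (hP h' (hx d hd))
      rw [if_neg hdt, mul_zero]
  refine rankZA_kernel_eq_zero hι F G hF hG hFm hGm a b c (fun d hd => (ha d hd).2) (fun d hd => (hb d hd).2)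
    (fun x d hd => (hc x d hd).2) ?_
  intro y t ht1 ht2
  by_cases htP : t ∈ P
  · exact h y t htP ht1 ht2
  · have hA : (if y = ⊤ then ∑ d, a d * (if d ⊆ t then (1 : ℚ) else 0) else 0) = 0 := by
      split_ifs
      · exact vanish a (fun d hd => (ha d hd).1) t htP
      · rfl
    have hC : ∑ x, (if x ≤ y then ∑ d, c x d * (if d ⊆ t then (1 : ℚ) else 0) else 0) = 0 := by
      refine Finset.sum_eq_zero fun x _ => ?_
      split_ifs
      · exact vanish (c x) (fun d hd => (hc x d hd).1) t htP
      · rfl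
    rw [hA, vanish b (fun d hd => (hb d hd).1) t htP, hC, add_zero, add_zero]

end FiveUpSet

end Summit.CriticalPhenomena.PercolationContinuityZ3.Theorems
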